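import Summits.NavierStokesRegularity.Statement
import Summits.NavierStokesRegularity.NavierStokesRegularity.Theorems.PlaneEnergyCeilingPlanarEnergyAPrioriTraceEdge
import Summits.NavierStokesRegularity.NavierStokesRegularity.Theorems.FrozenSignCascadeBoundedEnvelopeContinuationClayOfBackwardBounded
import HarnessLib

/-!
# Crux `PlanarEnergyAPriori` (stmt-NavierStokesRegularity-16855), route PlaneEnergyCeiling:
  a third admissible second layer — the planar ceiling plus TerminalTrace's density criterion close the summit

Helper file for the crux item stmt-NavierStokesRegularity-16855
(`Summit.NavierStokesRegularity.NavierStokesRegularity.Theses.PlaneEnergyCeiling.PlanarEnergyAPriori`).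

By `noTraceConcentration_of_planarEnergyAPriori` (`…PlanarEnergyAPrioriTraceEdge.lean`) the planar
ceiling gives crux (B) of route TerminalTrace: the final value of a frame solution has no scaled-energy
concentration anywhere. TerminalTrace's other crux (A), `TraceDensityCriterion`
(stmt-NavierStokesRegularity-18614: no concentration of `u(T)` at `x₀` ⇒ `u` bounded on a backward
cylinder below `(T, x₀)`), then makes EVERY top point backward bounded, and the landed per-datum
continuation theorem `BoundedEnvelope.stub_clayOfBackwardBounded`
(`Theorems/FrozenSignCascadeBoundedEnvelopeContinuationClayOfBackwardBounded.lean`: backward boundedness of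
every classical Leray–Hopf solution from `u₀` at every top point ⇒ Clay (A) for `u₀`) yields the summit:

* `navierStokesRegularity_of_planarEnergyAPriori_of_traceDensityCriterion` —
  `PlanarEnergyAPriori → TerminalTrace.TraceDensityCriterion → NavierStokesRegularity`;
* `target_of_planarEnergyAPriori_of_traceDensityCriterion` (registered anchor) — the same with the
  route's own `Target` as conclusion.

With `target_of_planarEnergyAPriori_of_noHardyTypeIAncient` (`…AltClosing.lean`) the route now has three
interchangeable second inputs next to crux 16855: its own Liouville crux `PlanarEnergyLiouville` (16856),
HardyPointSink's `NoHardyTypeIAncient` (7980), and TerminalTrace's `TraceDensityCriterion` (18614).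
-/

noncomputable section

-- Problem = summit for this single-conjunct summit: the duplicate namespace component is deliberate.
set_option linter.dupNamespace false

namespace Summit.NavierStokesRegularity.NavierStokesRegularity.Theorems.PlanarEnergyAPriori

open Summit.NavierStokesRegularity.NavierStokesRegularity
open Literature.Analysis.FluidPDE

/-- **Planar ceiling + TerminalTrace's density criterion ⇒ the summit.** Under the planar crux every
frame solution has a final value without scaled-energy concentration
(`noTraceConcentration_of_planarEnergyAPriori`); the criterion turns this into backward boundedness
at every top point, and `BoundedEnvelope.stub_clayOfBackwardBounded` continues the datum's solution
globally. -/
theorem navierStokesRegularity_of_planarEnergyAPriori_of_traceDensityCriterion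
    (h₁ : Theses.PlaneEnergyCeiling.PlanarEnergyAPriori)
    (h₂ : Theses.TerminalTrace.TraceDensityCriterion) : _root_.NavierStokesRegularity := by
  intro ν hν u₀ hsm hdiv hdec
  refine BoundedEnvelope.stub_clayOfBackwardBounded ν hν u₀ hsm hdec hdiv ?_
  intro T hT u p hcl hLH h0 x₀
  have hLH' : IsLerayHopfOn T ν 0 (u 0) u := by rw [h0]; exact hLH
  have hdec' : HasRapidSpatialDecay (u 0) := by rw [h0]; exact hdec
  exact h₂ ν T hν hT u p hcl hLH' hdec' x₀
    (noTraceConcentration_of_planarEnergyAPriori h₁ ν T hν hT u p hcl hLH' hdec' x₀)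

/-- **Registered anchor `target_of_planarEnergyAPriori_of_traceDensityCriterion`: a third admissible
second layer for route PlaneEnergyCeiling.** The route's target `X = PlanarEnergyAPriori ∧
BoundedPlanarEnergyRegularity` follows from the planar crux together with TerminalTrace's
`TraceDensityCriterion` (in place of `PlanarEnergyLiouville ∧ PlanarEnergyZoomA`). -/
theorem target_of_planarEnergyAPriori_of_traceDensityCriterion :
    Summit.NavierStokesRegularity.NavierStokesRegularity.Theses.PlaneEnergyCeiling.PlanarEnergyAPriori →
    Summit.NavierStokesRegularity.NavierStokesRegularity.Theses.TerminalTrace.TraceDensityCriterion →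
    Summit.NavierStokesRegularity.NavierStokesRegularity.Theses.PlaneEnergyCeiling.Target := by
  intro h₁ h₂
  refine ⟨h₁, fun ν hν u₀ hsm hdiv hdec _ => ?_⟩
  exact navierStokesRegularity_of_planarEnergyAPriori_of_traceDensityCriterion h₁ h₂ ν hν u₀ hsm hdiv hdec

end Summit.NavierStokesRegularity.NavierStokesRegularity.Theorems.PlanarEnergyAPriori

end
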